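import Literature.Computability.AlgebraicComplexity.WeightedEntropyMax
import HarnessLib

/-!
# The maximum entropy with prescribed marginals and the penalty term `P_α` of the asymmetric laser method

Topic `Literature/Computability/AlgebraicComplexity`.  In the global and constituent stages of the
laser method with asymmetric hashing (Duan–Wu–Zhou 2023; Vassilevska Williams–Xu–Xu–Zhou 2024,
§5 and §6) the number of retained blocks is governed, next to entropies of marginals, by the
**penalty term**

  `P_α := max_{α' ∈ D} H(α') − H(α) ≥ 0`,  `D` := the distributions with the same three marginals
  as `α` (VXXZ 2024, §5, second bullet; §6 likewise),

where `α` is a distribution on the level-`ℓ` constituent tensors `{(i,j,k) | i + j + k = 2^ℓ}` and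
`H` is the Shannon entropy in bits (§3.9).  `P_α` "is not a closed form in terms of `α`" (§8), and the
authors' optimisation encodes `α_max := argmax_{α' ∈ D} H(α')` through Lagrange multipliers
(§8, "Lagrange multipliers": linear constraints forcing `α_max` and `α` to have the same marginals,
`Σ α_max = 1`, `α_max ≥ 0`, and the first-order optimality condition

  `λ_X(i) + λ_Y(j) + λ_Z(k) + λ_S = ln α_max(i,j,k) + 1` for all `i + j + k = 2^{ℓ*}`   (FOC)

(in the program in the exponential form `exp(λ_X(i)+λ_Y(j)+λ_Z(k)+λ_S−1) = α_max(i,j,k)`, footnote),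
asserting: "Since the entropy function `H(·)` is strictly concave, any `α_max` satisfying these
constraints is guaranteed to have maximum entropy."

This file defines `D`, `max_{α'∈D} H(α')` and `P_α` for distributions on a product `ι × κ × μ`
supported in a finite set `Φ` (for VXXZ: `Φ = {(i,j,k) | i+j+k = 2^ℓ}` inside `[0,2^ℓ]³`), and PROVES

* `maxEntropyPenalty_nonneg` — `P_α ≥ 0` (as printed);
* `shannonEntropy_le_entropyDual` / `maxEntropyGivenMarginals_le_entropyDual` /
  `maxEntropyPenalty_le` — the **Lagrangian dual bound** (Gibbs' inequality with the Gibbs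
  distribution `exp(λ_X+λ_Y+λ_Z)/Z` on `Φ`): for ALL real `λ_X, λ_Y, λ_Z`,
  `max_{α'∈D} H(α') ≤ log₂ Σ_{Φ} exp(λ_X(i)+λ_Y(j)+λ_Z(k)) − (Σ_i α_X(i)λ_X(i) + Σ_j α_Y(j)λ_Y(j) + Σ_k α_Z(k)λ_Z(k)) / ln 2`,
  so that an upper bound for `P_α` — the direction in which `P_α` enters the constraints of
  Thms. 5.3/6.3 (`E ≤ H(α_X) − P_α`, …) — can be CERTIFIED from approximate multipliers without
  solving (FOC) exactly (the published parameter files satisfy (FOC) only to `10⁻¹⁰`,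
  cf. `RectangularExponentCert.lean`);
* `isMaxOn_shannonEntropy_of_lagrange` / `maxEntropyGivenMarginals_eq_of_lagrange` /
  `maxEntropyPenalty_eq_of_lagrange` — the printed claim of §8: an `α_max ∈ D` of the form (FOC)
  has maximum entropy in `D`, so `P_α = H(α_max) − H(α)` (the dual bound is attained at the true
  multipliers).

Entropy, marginals and the simplex are those of `QuantumFunctionals.lean` (`shannonEntropy` in bits,
`marginalDist₁₂₃`, `stdSimplex`); Gibbs' inequality is `sum_negMulLog_le_sum_mul_neg_log`
(`WeightedEntropyMax.lean`).

## References

* V. Vassilevska Williams, Y. Xu, Z. Xu, R. Zhou, *New bounds for matrix multiplication: from alpha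
  to omega*, SODA 2024, arXiv:2307.07970: §3.9 (entropy, base 2), §5 (definition of `D`, `P_α`;
  Prop. 5.1 / Thm. 5.3, `E_r`), §6 (Prop. 6.2 / Thm. 6.3), §8 "Lagrange multipliers" (marginal
  constraints on `α_max` and the first-order optimality condition; footnote: exponential form).
  [VassilevskaWilliamsXuXuZhou2024]
* R. Duan, H. Wu, R. Zhou, *Faster matrix multiplication via asymmetric hashing*, FOCS 2023
  (origin of the penalty/compatibility term).
* S. Boyd, L. Vandenberghe, *Convex Optimization* (2004), Ex. 5.3 / §5.1.6 (Lagrange dual of entropy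
  maximisation: `log Σ exp`). [folklore]
-/

noncomputable section

open scoped BigOperators
open Real (negMulLog)

namespace Literature.Computability.AlgebraicComplexity

variable {ι κ μ : Type*} [Fintype ι] [Fintype κ] [Fintype μ]

/-! ## `D`, `max_{α' ∈ D} H(α')` and `P_α` -/

section Defs

/-- **The class `D` of `α`** (VXXZ 2024, §5): the probability distributions on `ι × κ × μ`
supported in `Φ` whose three marginals coincide with those of `α`
(`α_X(i) = Σ_{j,k} α(i,j,k)` etc.). [cite: VassilevskaWilliamsXuXuZhou2024, §5 (definition of D)] -/
def sameMarginalsOn (Φ : Finset (ι × κ × μ)) (α : ι × κ × μ → ℝ) : Set (ι × κ × μ → ℝ) :=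
  {P | P ∈ stdSimplex ℝ (ι × κ × μ) ∧ (∀ x, x ∉ Φ → P x = 0) ∧ marginalDist₁ P = marginalDist₁ α ∧
    marginalDist₂ P = marginalDist₂ α ∧ marginalDist₃ P = marginalDist₃ α}

/-- **`max_{α' ∈ D} H(α')`**, the maximum entropy (bits) among distributions supported in `Φ` with
the marginals of `α` (a conditionally complete supremum over `ℝ`; the set is bounded by `log₂ |ι×κ×μ|`
and contains `H(α)` when `α` itself is a distribution supported in `Φ`).
[cite: VassilevskaWilliamsXuXuZhou2024, §5 (definition of P_α)] -/
def maxEntropyGivenMarginals (Φ : Finset (ι × κ × μ)) (α : ι × κ × μ → ℝ) : ℝ :=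
  sSup (shannonEntropy '' sameMarginalsOn Φ α)

/-- **The penalty term `P_α := max_{α' ∈ D} H(α') − H(α)`** of the asymmetric laser method.
[cite: VassilevskaWilliamsXuXuZhou2024, §5 (definition of P_α)] -/
def maxEntropyPenalty (Φ : Finset (ι × κ × μ)) (α : ι × κ × μ → ℝ) : ℝ :=
  maxEntropyGivenMarginals Φ α - shannonEntropy α

/-- **The Lagrangian dual function** of entropy maximisation over `D`, in bits: for multipliers
`λ_X, λ_Y, λ_Z` of the three marginal constraints,
`g(λ) = (ln Σ_{(i,j,k) ∈ Φ} e^{λ_X(i)+λ_Y(j)+λ_Z(k)} − Σ_i α_X(i)λ_X(i) − Σ_j α_Y(j)λ_Y(j) − Σ_k α_Z(k)λ_Z(k)) / ln 2`.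
It depends on `α` only through its marginals. [folklore] -/
def entropyDual (Φ : Finset (ι × κ × μ)) (lX : ι → ℝ) (lY : κ → ℝ) (lZ : μ → ℝ)
    (α : ι × κ × μ → ℝ) : ℝ :=
  (Real.log (∑ x ∈ Φ, Real.exp (lX x.1 + lY x.2.1 + lZ x.2.2)) -
    (∑ a, marginalDist₁ α a * lX a + ∑ b, marginalDist₂ α b * lY b +
      ∑ c, marginalDist₃ α c * lZ c)) / Real.log 2

end Defs

/-! ## Elementary properties -/

section Basic

variable {Φ : Finset (ι × κ × μ)} {α : ι × κ × μ → ℝ}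

/-- Unfolding of membership in `D`. [folklore] -/
theorem mem_sameMarginalsOn {P : ι × κ × μ → ℝ} :
    P ∈ sameMarginalsOn Φ α ↔ P ∈ stdSimplex ℝ (ι × κ × μ) ∧ (∀ x, x ∉ Φ → P x = 0) ∧
      marginalDist₁ P = marginalDist₁ α ∧ marginalDist₂ P = marginalDist₂ α ∧
      marginalDist₃ P = marginalDist₃ α :=
  Iff.rfl

/-- A distribution supported in `Φ` belongs to its own class `D`. [folklore] -/
theorem self_mem_sameMarginalsOn (hα : α ∈ stdSimplex ℝ (ι × κ × μ)) (hΦ : ∀ x, x ∉ Φ → α x = 0) :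
    α ∈ sameMarginalsOn Φ α :=
  ⟨hα, hΦ, rfl, rfl, rfl⟩

/-- `D` depends on `α` only through its marginals: `D(α') = D(α)` for `α' ∈ D(α)`. [folklore] -/
theorem sameMarginalsOn_eq_of_mem {P : ι × κ × μ → ℝ} (hP : P ∈ sameMarginalsOn Φ α) :
    sameMarginalsOn Φ P = sameMarginalsOn Φ α := by
  ext Q
  simp only [mem_sameMarginalsOn, hP.2.2.1, hP.2.2.2.1, hP.2.2.2.2]

/-- The entropies over `D` are bounded above (by `log₂ |ι × κ × μ|`). [folklore] -/
theorem bddAbove_shannonEntropy_image_sameMarginalsOn (Φ : Finset (ι × κ × μ)) (α : ι × κ × μ → ℝ) :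
    BddAbove (shannonEntropy '' sameMarginalsOn Φ α) := by
  refine ⟨Real.log (Fintype.card (ι × κ × μ)) / Real.log 2, ?_⟩
  rintro _ ⟨P, hP, rfl⟩
  exact shannonEntropy_le_of_mem_stdSimplex hP.1

/-- `H(α') ≤ max_{D} H` for every `α' ∈ D`. [folklore] -/
theorem shannonEntropy_le_maxEntropyGivenMarginals {P : ι × κ × μ → ℝ} (hP : P ∈ sameMarginalsOn Φ α) :
    shannonEntropy P ≤ maxEntropyGivenMarginals Φ α :=
  le_csSup (bddAbove_shannonEntropy_image_sameMarginalsOn Φ α) ⟨P, hP, rfl⟩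

/-- `max_{D} H ≤ B` as soon as `H(α') ≤ B` on `D` and `D ≠ ∅`. [folklore] -/
theorem maxEntropyGivenMarginals_le {B : ℝ} (hne : (sameMarginalsOn Φ α).Nonempty)
    (hB : ∀ P ∈ sameMarginalsOn Φ α, shannonEntropy P ≤ B) : maxEntropyGivenMarginals Φ α ≤ B :=
  csSup_le (hne.image _) (by rintro _ ⟨P, hP, rfl⟩; exact hB P hP)

/-- **`P_α ≥ 0`** for a distribution `α` supported in `Φ` (VXXZ 2024, §5: "`P_α … ≥ 0`").
[cite: VassilevskaWilliamsXuXuZhou2024, §5 (definition of P_α)] -/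
theorem maxEntropyPenalty_nonneg (hα : α ∈ stdSimplex ℝ (ι × κ × μ)) (hΦ : ∀ x, x ∉ Φ → α x = 0) :
    0 ≤ maxEntropyPenalty Φ α :=
  sub_nonneg.2 (shannonEntropy_le_maxEntropyGivenMarginals (self_mem_sameMarginalsOn hα hΦ))

/-- `P_α` depends on `α` through `H(α)` and the marginals only: for `α' ∈ D(α)`,
`max_{D(α')} H = max_{D(α)} H`. [folklore] -/
theorem maxEntropyGivenMarginals_eq_of_mem {P : ι × κ × μ → ℝ} (hP : P ∈ sameMarginalsOn Φ α) :
    maxEntropyGivenMarginals Φ P = maxEntropyGivenMarginals Φ α := by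
  rw [maxEntropyGivenMarginals, maxEntropyGivenMarginals, sameMarginalsOn_eq_of_mem hP]

end Basic

/-! ## The Lagrangian dual bound (Gibbs' inequality) -/

section Dual

variable {Φ : Finset (ι × κ × μ)} {α : ι × κ × μ → ℝ}

/-- The pairing of a function on `ι × κ × μ` with a sum of one-variable potentials is a pairing of
its marginals: `Σ_x P(x) (λ_X(x₁) + λ_Y(x₂) + λ_Z(x₃)) = Σ_i P_X(i) λ_X(i) + Σ_j P_Y(j) λ_Y(j) + Σ_k P_Z(k) λ_Z(k)`.
[folklore] -/
theorem sum_mul_potential_eq_marginals (P : ι × κ × μ → ℝ) (lX : ι → ℝ) (lY : κ → ℝ) (lZ : μ → ℝ) :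
    ∑ x, P x * (lX x.1 + lY x.2.1 + lZ x.2.2) =
      ∑ a, marginalDist₁ P a * lX a + ∑ b, marginalDist₂ P b * lY b +
        ∑ c, marginalDist₃ P c * lZ c := by
  have h1 : ∑ x, P x * lX x.1 = ∑ a, marginalDist₁ P a * lX a := by
    simp only [marginalDist₁, Fintype.sum_prod_type, Finset.sum_mul]
  have h2 : ∑ x, P x * lY x.2.1 = ∑ b, marginalDist₂ P b * lY b := by
    simp only [marginalDist₂, Fintype.sum_prod_type, Finset.sum_mul]
    rw [Finset.sum_comm]
  have h3 : ∑ x, P x * lZ x.2.2 = ∑ c, marginalDist₃ P c * lZ c := by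
    simp only [marginalDist₃, Fintype.sum_prod_type, Finset.sum_mul]
    calc ∑ a, ∑ b, ∑ c, P (a, b, c) * lZ c = ∑ a, ∑ c, ∑ b, P (a, b, c) * lZ c :=
          Finset.sum_congr rfl fun a _ => Finset.sum_comm
      _ = ∑ c, ∑ a, ∑ b, P (a, b, c) * lZ c := Finset.sum_comm
  simp only [mul_add, Finset.sum_add_distrib, h1, h2, h3]

/-- **Gibbs' inequality against the Gibbs distribution on `Φ`**: for every probability distribution
`P` supported in `Φ` and all potentials `λ_X, λ_Y, λ_Z`,
`H(P) ≤ (ln Σ_{Φ} e^{λ_X+λ_Y+λ_Z} − Σ_x P(x)(λ_X(x₁)+λ_Y(x₂)+λ_Z(x₃))) / ln 2`. [folklore] -/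
theorem shannonEntropy_le_log_sum_exp_sub {P : ι × κ × μ → ℝ} (hP : P ∈ stdSimplex ℝ (ι × κ × μ))
    (hPΦ : ∀ x, x ∉ Φ → P x = 0) (lX : ι → ℝ) (lY : κ → ℝ) (lZ : μ → ℝ) :
    shannonEntropy P ≤
      (Real.log (∑ x ∈ Φ, Real.exp (lX x.1 + lY x.2.1 + lZ x.2.2)) -
        ∑ x, P x * (lX x.1 + lY x.2.1 + lZ x.2.2)) / Real.log 2 := by
  classical
  set L : ι × κ × μ → ℝ := fun x => lX x.1 + lY x.2.1 + lZ x.2.2 with hL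
  set Z : ℝ := ∑ x ∈ Φ, Real.exp (L x) with hZ
  -- `Φ` is nonempty since `P` is a distribution supported in it
  have hΦne : Φ.Nonempty := by
    by_contra hΦ
    rw [Finset.not_nonempty_iff_eq_empty] at hΦ
    have h0 : ∀ x, P x = 0 := fun x => hPΦ x (by simp [hΦ])
    have := hP.2
    simp [h0] at this
  have hZpos : 0 < Z := Finset.sum_pos (fun x _ => Real.exp_pos _) hΦne
  -- the Gibbs distribution `Q = 1_Φ e^L / Z`
  set Q : ι × κ × μ → ℝ := fun x => if x ∈ Φ then Real.exp (L x) / Z else 0 with hQ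
  have hQ0 : ∀ x, 0 ≤ Q x := fun x => by
    simp only [hQ]
    split_ifs
    · exact div_nonneg (Real.exp_pos _).le hZpos.le
    · exact le_rfl
  have hQ1 : ∑ x, Q x ≤ 1 := by
    have : ∑ x, Q x = 1 := by
      simp only [hQ]
      rw [← Finset.sum_filter, Finset.filter_mem_eq_inter, Finset.univ_inter, ← Finset.sum_div,
        div_self hZpos.ne']
    exact this.le
  have hPQ : ∀ x, P x ≠ 0 → 0 < Q x := fun x hx => by
    have hxΦ : x ∈ Φ := by
      by_contra h
      exact hx (hPΦ x h)
    simp only [hQ, hxΦ, if_true]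
    exact div_pos (Real.exp_pos _) hZpos
  have hG := sum_negMulLog_le_sum_mul_neg_log hP.1 hP.2 hQ0 hQ1 hPQ
  -- evaluate `-log Q` on the support of `P`
  have hlogQ : ∀ x, P x * (-Real.log (Q x)) = P x * (Real.log Z - L x) := fun x => by
    by_cases hx : P x = 0
    · simp [hx]
    · have hxΦ : x ∈ Φ := by
        by_contra h
        exact hx (hPΦ x h)
      simp only [hQ, hxΦ, if_true]
      rw [Real.log_div (Real.exp_pos _).ne' hZpos.ne', Real.log_exp]
      ring
  have hsum : ∑ x, P x * (-Real.log (Q x)) = Real.log Z - ∑ x, P x * L x := by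
    rw [Finset.sum_congr rfl fun x _ => hlogQ x]
    simp only [mul_sub, Finset.sum_sub_distrib, ← Finset.sum_mul, hP.2, one_mul]
  rw [shannonEntropy_def]
  exact div_le_div_of_nonneg_right (hG.trans_eq hsum) (Real.log_nonneg one_le_two)

/-- **The Lagrangian dual bound for `max_{α'∈D} H(α')`, pointwise**: every `α' ∈ D(α)` has
`H(α') ≤ g(λ)` for all multipliers `λ_X, λ_Y, λ_Z` (weak duality: Gibbs' inequality, and the linear
term depends only on the common marginals). [folklore] -/
theorem shannonEntropy_le_entropyDual {P : ι × κ × μ → ℝ} (hP : P ∈ sameMarginalsOn Φ α)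
    (lX : ι → ℝ) (lY : κ → ℝ) (lZ : μ → ℝ) :
    shannonEntropy P ≤ entropyDual Φ lX lY lZ α := by
  have h := shannonEntropy_le_log_sum_exp_sub hP.1 hP.2.1 lX lY lZ
  rw [sum_mul_potential_eq_marginals, hP.2.2.1, hP.2.2.2.1, hP.2.2.2.2] at h
  exact h

/-- **Weak duality**: `max_{α' ∈ D} H(α') ≤ g(λ)` for all `λ_X, λ_Y, λ_Z`, for a distribution `α`
supported in `Φ`. [folklore] -/
theorem maxEntropyGivenMarginals_le_entropyDual (hα : α ∈ stdSimplex ℝ (ι × κ × μ))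
    (hΦ : ∀ x, x ∉ Φ → α x = 0) (lX : ι → ℝ) (lY : κ → ℝ) (lZ : μ → ℝ) :
    maxEntropyGivenMarginals Φ α ≤ entropyDual Φ lX lY lZ α :=
  maxEntropyGivenMarginals_le ⟨α, self_mem_sameMarginalsOn hα hΦ⟩
    fun _ hP => shannonEntropy_le_entropyDual hP lX lY lZ

/-- **A certifiable upper bound for the penalty term**: for a distribution `α` supported in `Φ` and
ANY real `λ_X, λ_Y, λ_Z`,
`P_α ≤ (ln Σ_{Φ} e^{λ_X(i)+λ_Y(j)+λ_Z(k)} − Σ_i α_X(i)λ_X(i) − Σ_j α_Y(j)λ_Y(j) − Σ_k α_Z(k)λ_Z(k)) / ln 2 − H(α)`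
(tight at the Lagrange multipliers of §8, `maxEntropyPenalty_eq_of_lagrange`). [folklore] -/
theorem maxEntropyPenalty_le (hα : α ∈ stdSimplex ℝ (ι × κ × μ)) (hΦ : ∀ x, x ∉ Φ → α x = 0)
    (lX : ι → ℝ) (lY : κ → ℝ) (lZ : μ → ℝ) :
    maxEntropyPenalty Φ α ≤ entropyDual Φ lX lY lZ α - shannonEntropy α :=
  sub_le_sub_right (maxEntropyGivenMarginals_le_entropyDual hα hΦ lX lY lZ) _

/-- The crude case `λ = 0`: `max_{D} H ≤ log₂ |Φ|`, i.e. `P_α ≤ log₂ |Φ| − H(α)`. [folklore] -/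
theorem maxEntropyGivenMarginals_le_logb_card (hα : α ∈ stdSimplex ℝ (ι × κ × μ))
    (hΦ : ∀ x, x ∉ Φ → α x = 0) :
    maxEntropyGivenMarginals Φ α ≤ Real.log Φ.card / Real.log 2 := by
  have h := maxEntropyGivenMarginals_le_entropyDual hα hΦ (fun _ => 0) (fun _ => 0) (fun _ => 0)
  simpa [entropyDual] using h

end Dual

/-! ## The Lagrange-multiplier characterisation of `α_max` (VXXZ 2024, §8) -/

section Lagrange

variable {Φ : Finset (ι × κ × μ)} {α : ι × κ × μ → ℝ}

/-- At multipliers satisfying the first-order condition of §8 the dual function equals the entropy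
of `α_max`:
if `α_max ∈ D(α)` and `e^{λ_X(i)+λ_Y(j)+λ_Z(k)+λ_S−1} = α_max(i,j,k)` on `Φ`, then
`g(λ_X, λ_Y, λ_Z) = H(α_max)`. [cite: VassilevskaWilliamsXuXuZhou2024, §8 (Lagrange multipliers, first-order optimality condition)] -/
theorem entropyDual_eq_shannonEntropy_of_lagrange {αmax : ι × κ × μ → ℝ}
    (hmax : αmax ∈ sameMarginalsOn Φ α) {lX : ι → ℝ} {lY : κ → ℝ} {lZ : μ → ℝ} {lS : ℝ}
    (hlag : ∀ x ∈ Φ, Real.exp (lX x.1 + lY x.2.1 + lZ x.2.2 + lS - 1) = αmax x) :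
    entropyDual Φ lX lY lZ α = shannonEntropy αmax := by
  classical
  set L : ι × κ × μ → ℝ := fun x => lX x.1 + lY x.2.1 + lZ x.2.2 with hL
  -- (1) the partition function: `Σ_Φ e^L = e^{1 - λ_S}`
  have hexp : ∀ x ∈ Φ, Real.exp (L x) = αmax x * Real.exp (1 - lS) := fun x hx => by
    rw [← hlag x hx, ← Real.exp_add]
    congr 1
    simp only [hL]
    ring
  have hsumΦ : ∑ x ∈ Φ, αmax x = 1 := by
    rw [← hmax.1.2]
    exact Finset.sum_subset (Finset.subset_univ _) fun x _ hx => hmax.2.1 x hx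
  have hZ : ∑ x ∈ Φ, Real.exp (L x) = Real.exp (1 - lS) := by
    rw [Finset.sum_congr rfl hexp, ← Finset.sum_mul, hsumΦ, one_mul]
  -- (2) the linear term, computed with `αmax` (same marginals as `α`)
  have hlin : ∑ a, marginalDist₁ α a * lX a + ∑ b, marginalDist₂ α b * lY b +
      ∑ c, marginalDist₃ α c * lZ c = ∑ x, αmax x * L x := by
    rw [← hmax.2.2.1, ← hmax.2.2.2.1, ← hmax.2.2.2.2, ← sum_mul_potential_eq_marginals]
  have hLx : ∀ x, αmax x * L x = -negMulLog (αmax x) + αmax x * (1 - lS) := fun x => by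
    by_cases hx : x ∈ Φ
    · have hpos : 0 < αmax x := by rw [← hlag x hx]; exact Real.exp_pos _
      have hlog : Real.log (αmax x) = L x + lS - 1 := by
        rw [← hlag x hx, Real.log_exp]
      simp only [Real.negMulLog, hlog]
      ring
    · simp [hmax.2.1 x hx, Real.negMulLog]
  have hlin' : ∑ x, αmax x * L x = -∑ x, negMulLog (αmax x) + (1 - lS) := by
    rw [Finset.sum_congr rfl fun x _ => hLx x, Finset.sum_add_distrib, Finset.sum_neg_distrib,
      ← Finset.sum_mul, hmax.1.2, one_mul]
  -- (3) assemble
  rw [entropyDual, shannonEntropy_def, hlin, hlin']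
  simp only [hL] at hZ ⊢
  rw [hZ, Real.log_exp]
  congr 1
  ring

/-- **VXXZ 2024, §8: Lagrange multipliers certify the maximum entropy.**  If `α_max ∈ D(α)` (the
linear constraints of §8: same marginals as `α`, `Σ α_max = 1`, `α_max ≥ 0`) satisfies the first-order
optimality condition `λ_X(i)+λ_Y(j)+λ_Z(k)+λ_S = ln α_max(i,j,k) + 1` on `Φ` — stated in the
exponential form used in the authors' program, `e^{λ_X(i)+λ_Y(j)+λ_Z(k)+λ_S−1} = α_max(i,j,k)`
(§8, footnote) — then `α_max` has maximum entropy in `D(α)` ("Since the entropy function `H(·)` is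
strictly concave, any `α_max` satisfying these constraints is guaranteed to have maximum entropy").
Proof: weak duality `H(α') ≤ g(λ)` on `D` and `g(λ) = H(α_max)`.
[cite: VassilevskaWilliamsXuXuZhou2024, §8 (Lagrange multipliers, first-order optimality condition)] -/
theorem isMaxOn_shannonEntropy_of_lagrange {αmax : ι × κ × μ → ℝ}
    (hmax : αmax ∈ sameMarginalsOn Φ α) {lX : ι → ℝ} {lY : κ → ℝ} {lZ : μ → ℝ} {lS : ℝ}
    (hlag : ∀ x ∈ Φ, Real.exp (lX x.1 + lY x.2.1 + lZ x.2.2 + lS - 1) = αmax x) :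
    IsMaxOn shannonEntropy (sameMarginalsOn Φ α) αmax := fun P hP => by
  rw [Set.mem_setOf_eq, ← entropyDual_eq_shannonEntropy_of_lagrange hmax hlag]
  exact shannonEntropy_le_entropyDual hP lX lY lZ

/-- Under the first-order condition of §8, `max_{α' ∈ D} H(α') = H(α_max)` (the supremum is
attained at `α_max`). [cite: VassilevskaWilliamsXuXuZhou2024, §8 (Lagrange multipliers)] -/
theorem maxEntropyGivenMarginals_eq_of_lagrange {αmax : ι × κ × μ → ℝ}
    (hmax : αmax ∈ sameMarginalsOn Φ α) {lX : ι → ℝ} {lY : κ → ℝ} {lZ : μ → ℝ} {lS : ℝ}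
    (hlag : ∀ x ∈ Φ, Real.exp (lX x.1 + lY x.2.1 + lZ x.2.2 + lS - 1) = αmax x) :
    maxEntropyGivenMarginals Φ α = shannonEntropy αmax :=
  IsGreatest.csSup_eq ⟨⟨αmax, hmax, rfl⟩, by
    rintro _ ⟨P, hP, rfl⟩
    exact isMaxOn_shannonEntropy_of_lagrange hmax hlag hP⟩

/-- Under the first-order condition of §8, **`P_α = H(α_max) − H(α)`** — the closed form through
which the penalty term enters
the authors' optimisation program. [cite: VassilevskaWilliamsXuXuZhou2024, §8 (Lagrange multipliers)] -/
theorem maxEntropyPenalty_eq_of_lagrange {αmax : ι × κ × μ → ℝ}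
    (hmax : αmax ∈ sameMarginalsOn Φ α) {lX : ι → ℝ} {lY : κ → ℝ} {lZ : μ → ℝ} {lS : ℝ}
    (hlag : ∀ x ∈ Φ, Real.exp (lX x.1 + lY x.2.1 + lZ x.2.2 + lS - 1) = αmax x) :
    maxEntropyPenalty Φ α = shannonEntropy αmax - shannonEntropy α := by
  rw [maxEntropyPenalty, maxEntropyGivenMarginals_eq_of_lagrange hmax hlag]

/-- The dual bound is TIGHT at the multipliers of §8: `g(λ) = max_{D} H`. [folklore] -/
theorem entropyDual_eq_maxEntropyGivenMarginals_of_lagrange {αmax : ι × κ × μ → ℝ}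
    (hmax : αmax ∈ sameMarginalsOn Φ α) {lX : ι → ℝ} {lY : κ → ℝ} {lZ : μ → ℝ} {lS : ℝ}
    (hlag : ∀ x ∈ Φ, Real.exp (lX x.1 + lY x.2.1 + lZ x.2.2 + lS - 1) = αmax x) :
    entropyDual Φ lX lY lZ α = maxEntropyGivenMarginals Φ α := by
  rw [maxEntropyGivenMarginals_eq_of_lagrange hmax hlag,
    entropyDual_eq_shannonEntropy_of_lagrange hmax hlag]

end Lagrange

end Literature.Computability.AlgebraicComplexity

end
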